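import Mathlib
import HarnessLib
import Summits.HubbardSuperconductivity.HubbardSuperconductivity.Theorems.KLProgrammeKLRegimeEnginePairLadderLinearDressing

/-!
# Route `KLProgramme` — crux K3, ENGINE child gen 8 (stmt-HubbardSuperconductivity-20437 `KLRegimeEngineV17F2`), stub (c) `stub_engine_step_values`,
# (R47h) v2 / RIDER (A): the WEIGHTED tangent Duhamel bound for the linearly dressed flow — `kltc_tangent_duhamel`

Cell gate-hubbard-kl, seat hubbard-kl-k3c1-p1 (g9), technique «composed-map remainder propagation».  Sequel to `…EnginePairLadderLinearDressing`
(p541767: sup Gronwall `kltc_linear_dressing_gronwall`, exact conjugation identity `kltc_tangent_conj_identity` / `kltc_tangent_conj_hasDerivAt`).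
The linearly dressed flow `Ė = −(Γ₁·diag ḃ₁·E + E·diag ḃ₂·Γ₂) + X` of a remainder tracker (sextic-tree remainder at chain labels, transfer defect,
E2-TRANSFER-SQUARE §3) is the TANGENT flow of the pair-ladder Riccati flow; conjugating by the explicit resolvent factors
`P_t = 1 + Γ₁(0)·diag(b₁(t) − b₁(0))`, `Q_t = 1 + diag(b₂(t) − b₂(0))·Γ₂(0)` leaves `d/dt(P·E·Q) = −e₁·Ẇ₁·E·Q − P·E·Ẇ₂·e₂ + P·X·Q` with the dressers'
Bethe–Salpeter defects `e₁ = PΓ₁ − Γ₁(0)`, `e₂ = Γ₂Q − Γ₂(0)`; integrating (FTC, entrywise) and undoing the conjugation with the two-sided inverses of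
`P₁`, `Q₁` (`klcrs_single_slice`) gives **`kltc_tangent_duhamel`**: an ENTRYWISE four-term bound
`‖E(1)(x,y)‖ ≤ S(x,y) + Σ_c S(x,c)ρ₂(c)(3m/2) + Σ_a (3m/2)ρ₁(a)S(a,y) + ΣΣ (3m/2)ρ₁(a)S(a,c)ρ₂(c)(3m/2)` with
`S ≥ |E(0)| + FT_{ρ}(∫₀¹|X|) + (4/3)Bβ(η₁+η₂)` — the source enters through its WEIGHTED slice integral (the form the (E2) budgets consume via angular
masses, cf. `kltc_riccati_duhamel_weighted` p500198 for the Riccati flow itself), the defects `η_i` only through one uniform term.  The entrywise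
plumbing (`kltc_sandwich2_entry_le`, `kltc_colsum_affine_le` / `kltc_rowsum_affine_le`, `kltc_continuousOn_*_apply`) is §3 of `…LinearDressing`.

Real analysis + matrix algebra only; nothing about the model is asserted.  0 kit.
-/

noncomputable section

namespace Summit.HubbardSuperconductivity.HubbardSuperconductivity.Theorems.KLRegimeSplit

set_option linter.dupNamespace false -- summit = problem name (single-conjunct summit), D-0017

open Finset Matrix Set
open Summit.HubbardSuperconductivity.HubbardSuperconductivity.Theorems.KLProgrammeCooperResummation

section TangentDuhamel

variable {ι : Type*} [Fintype ι] [DecidableEq ι] [Nonempty ι]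

set_option maxHeartbeats 1600000 in -- one long real-analysis proof (FTC + entrywise bookkeeping)
/-- **Weighted tangent Duhamel bound for the two-sided linearly dressed flow.**  On `[0,1]`: `E` entrywise-C¹ (`Ė` continuous) with
`Ė = −(Γ₁·diag ḃ₁·E + E·diag ḃ₂·Γ₂) + X` (`X` entrywise continuous); cumulative weights `b_i` with continuous rates `ḃ_i`, `Σ_a‖ḃ_i(t)_a‖ ≤ β`,
accumulated profiles `‖b_i(t)_a − b_i(0)_a‖ ≤ ρ_i(a)` with `m·Σρ_i ≤ 1/3`; dressers `|Γ_i(t)| ≤ m` with Bethe–Salpeter defects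
`‖((1 + Γ₁(0)·diag(b₁(t)−b₁(0)))·Γ₁(t) − Γ₁(0))(x,y)‖ ≤ η₁`, `‖(Γ₂(t)·(1 + diag(b₂(t)−b₂(0))·Γ₂(0)) − Γ₂(0))(x,y)‖ ≤ η₂` (these are `O(∫|source|)`
when the `Γ_i` run Riccati flows — the internal bound of `kllf_duhamel`); an a priori bound `|E(t)| ≤ B` (e.g. from `kltc_linear_dressing_le`).
With majorants `I(a,c) ≥ ∫₀¹‖X(t)(a,c)‖dt` and
`S(a,c) ≥ ‖E(0)(a,c)‖ + [I(a,c) + Σ_{c′} I(a,c′)ρ₂(c′)m + Σ_{a′} mρ₁(a′)I(a′,c) + Σ_{a′}Σ_{c′} mρ₁(a′)I(a′,c′)ρ₂(c′)m] + (4/3)·B·β·(η₁ + η₂)`: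
`‖E(1)(x,y)‖ ≤ S(x,y) + Σ_c S(x,c)ρ₂(c)(3m/2) + Σ_a (3m/2)ρ₁(a)S(a,y) + Σ_aΣ_c (3m/2)ρ₁(a)S(a,c)ρ₂(c)(3m/2)` — the source enters through its
WEIGHTED slice integral, the defects only through the uniform `(4/3)Bβ(η₁+η₂)`. -/
theorem kltc_tangent_duhamel (E E' X Γ₁ Γ₂ : ℝ → Matrix ι ι ℂ) (b₁ b₂ b₁' b₂' : ℝ → ι → ℂ) (ρ₁ ρ₂ : ι → ℝ) (I S : ι → ι → ℝ)
    {m β B η₁ η₂ : ℝ} (hm : 0 ≤ m) (hB : 0 ≤ B) (hη₁ : 0 ≤ η₁) (hη₂ : 0 ≤ η₂)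
    (hE : ∀ t ∈ Icc (0 : ℝ) 1, ∀ x y, HasDerivAt (fun s => E s x y) (E' t x y) t)
    (hE'c : ∀ x y, ContinuousOn (fun t => E' t x y) (Icc 0 1))
    (hb₁ : ∀ t ∈ Icc (0 : ℝ) 1, ∀ a, HasDerivAt (fun s => b₁ s a) (b₁' t a) t)
    (hb₂ : ∀ t ∈ Icc (0 : ℝ) 1, ∀ a, HasDerivAt (fun s => b₂ s a) (b₂' t a) t)
    (hb₁'c : ∀ a, ContinuousOn (fun t => b₁' t a) (Icc 0 1)) (hb₂'c : ∀ a, ContinuousOn (fun t => b₂' t a) (Icc 0 1))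
    (hXc : ∀ x y, ContinuousOn (fun t => X t x y) (Icc 0 1))
    (hflow : ∀ t ∈ Icc (0 : ℝ) 1, E' t = -(Γ₁ t * diagonal (b₁' t) * E t + E t * diagonal (b₂' t) * Γ₂ t) + X t)
    (hΓ₁ : ∀ t ∈ Icc (0 : ℝ) 1, ∀ x y, ‖Γ₁ t x y‖ ≤ m) (hΓ₂ : ∀ t ∈ Icc (0 : ℝ) 1, ∀ x y, ‖Γ₂ t x y‖ ≤ m)
    (hβ₁ : ∀ t ∈ Icc (0 : ℝ) 1, ∑ a, ‖b₁' t a‖ ≤ β) (hβ₂ : ∀ t ∈ Icc (0 : ℝ) 1, ∑ a, ‖b₂' t a‖ ≤ β)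
    (hρ₁ : ∀ t ∈ Icc (0 : ℝ) 1, ∀ a, ‖b₁ t a - b₁ 0 a‖ ≤ ρ₁ a) (hρ₂ : ∀ t ∈ Icc (0 : ℝ) 1, ∀ a, ‖b₂ t a - b₂ 0 a‖ ≤ ρ₂ a)
    (hZ₁ : m * ∑ a, ρ₁ a ≤ 1 / 3) (hZ₂ : m * ∑ a, ρ₂ a ≤ 1 / 3)
    (hEB : ∀ t ∈ Icc (0 : ℝ) 1, ∀ x y, ‖E t x y‖ ≤ B)
    (hdef₁ : ∀ t ∈ Icc (0 : ℝ) 1, ∀ x y, ‖((1 + Γ₁ 0 * diagonal (fun a => b₁ t a - b₁ 0 a)) * Γ₁ t - Γ₁ 0) x y‖ ≤ η₁)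
    (hdef₂ : ∀ t ∈ Icc (0 : ℝ) 1, ∀ x y, ‖(Γ₂ t * (1 + diagonal (fun a => b₂ t a - b₂ 0 a) * Γ₂ 0) - Γ₂ 0) x y‖ ≤ η₂)
    (hI : ∀ a c, (∫ t in (0 : ℝ)..1, ‖X t a c‖) ≤ I a c)
    (hS : ∀ a c, ‖E 0 a c‖ + (I a c + ∑ c', I a c' * ρ₂ c' * m + ∑ a', m * ρ₁ a' * I a' c +
        ∑ a', ∑ c', m * ρ₁ a' * I a' c' * ρ₂ c' * m) + 4 / 3 * B * β * (η₁ + η₂) ≤ S a c) (x y : ι) :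
    ‖E 1 x y‖ ≤ S x y + ∑ c, S x c * ρ₂ c * (3 / 2 * m) + ∑ a, 3 / 2 * m * ρ₁ a * S a y +
      ∑ a, ∑ c, 3 / 2 * m * ρ₁ a * S a c * ρ₂ c * (3 / 2 * m) := by
  have h01 : (0 : ℝ) ∈ Icc (0 : ℝ) 1 := ⟨le_rfl, zero_le_one⟩
  have h11 : (1 : ℝ) ∈ Icc (0 : ℝ) 1 := ⟨zero_le_one, le_rfl⟩
  have hsub : uIcc (0 : ℝ) 1 ⊆ Icc 0 1 := by rw [Set.uIcc_of_le zero_le_one]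
  have hρ₁0 : ∀ a, 0 ≤ ρ₁ a := fun a => by have h := hρ₁ 0 h01 a; rw [sub_self, norm_zero] at h; exact h
  have hρ₂0 : ∀ a, 0 ≤ ρ₂ a := fun a => by have h := hρ₂ 0 h01 a; rw [sub_self, norm_zero] at h; exact h
  have hβ0 : 0 ≤ β := (sum_nonneg fun a _ => norm_nonneg _).trans (hβ₁ 0 h01)
  -- cumulative weights
  set w₁ : ℝ → ι → ℂ := fun t a => b₁ t a - b₁ 0 a with hw₁_def
  set w₂ : ℝ → ι → ℂ := fun t a => b₂ t a - b₂ 0 a with hw₂_def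
  have hw₁0 : w₁ 0 = 0 := by funext a; show b₁ 0 a - b₁ 0 a = 0; exact sub_self _
  have hw₂0 : w₂ 0 = 0 := by funext a; show b₂ 0 a - b₂ 0 a = 0; exact sub_self _
  have hw₁d : ∀ t ∈ Icc (0 : ℝ) 1, ∀ a, HasDerivAt (fun s => w₁ s a) (b₁' t a) t :=
    fun t ht a => (hb₁ t ht a).sub_const (b₁ 0 a)
  have hw₂d : ∀ t ∈ Icc (0 : ℝ) 1, ∀ a, HasDerivAt (fun s => w₂ s a) (b₂' t a) t :=
    fun t ht a => (hb₂ t ht a).sub_const (b₂ 0 a)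
  have hw₁n : ∀ t ∈ Icc (0 : ℝ) 1, ∀ a, ‖w₁ t a‖ ≤ ρ₁ a := fun t ht a => hρ₁ t ht a
  have hw₂n : ∀ t ∈ Icc (0 : ℝ) 1, ∀ a, ‖w₂ t a‖ ≤ ρ₂ a := fun t ht a => hρ₂ t ht a
  have hw₁c : ∀ a, ContinuousOn (fun t => w₁ t a) (Icc 0 1) := fun a t ht => (hw₁d t ht a).continuousAt.continuousWithinAt
  have hw₂c : ∀ a, ContinuousOn (fun t => w₂ t a) (Icc 0 1) := fun a t ht => (hw₂d t ht a).continuousAt.continuousWithinAt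
  have hEc : ∀ a c, ContinuousOn (fun t => E t a c) (Icc 0 1) := fun a c t ht => (hE t ht a c).continuousAt.continuousWithinAt
  -- conjugators
  set P : ℝ → Matrix ι ι ℂ := fun t => 1 + Γ₁ 0 * diagonal (w₁ t) with hP_def
  set Q : ℝ → Matrix ι ι ℂ := fun t => 1 + diagonal (w₂ t) * Γ₂ 0 with hQ_def
  have hd0 : diagonal (0 : ι → ℂ) = 0 := diagonal_zero
  have hP0 : P 0 = 1 := by
    show 1 + Γ₁ 0 * diagonal (w₁ 0) = 1
    rw [hw₁0, hd0, mul_zero, add_zero]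
  have hQ0 : Q 0 = 1 := by
    show 1 + diagonal (w₂ 0) * Γ₂ 0 = 1
    rw [hw₂0, hd0, zero_mul, add_zero]
  have hdef₁' : ∀ t ∈ Icc (0 : ℝ) 1, ∀ u v, ‖(P t * Γ₁ t - Γ₁ 0) u v‖ ≤ η₁ := fun t ht u v => hdef₁ t ht u v
  have hdef₂' : ∀ t ∈ Icc (0 : ℝ) 1, ∀ u v, ‖(Γ₂ t * Q t - Γ₂ 0) u v‖ ≤ η₂ := fun t ht u v => hdef₂ t ht u v
  have hPc : ∀ a c, ContinuousOn (fun t => P t a c) (Icc 0 1) := fun a c =>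
    kltc_continuousOn_add_apply (A := fun _ => (1 : Matrix ι ι ℂ)) (B := fun t => Γ₁ 0 * diagonal (w₁ t))
      (fun _ _ => continuousOn_const)
      (kltc_continuousOn_mul_apply (A := fun _ => Γ₁ 0) (B := fun t => diagonal (w₁ t)) (fun _ _ => continuousOn_const)
        (kltc_continuousOn_diagonal_apply hw₁c)) a c
  have hQc : ∀ a c, ContinuousOn (fun t => Q t a c) (Icc 0 1) := fun a c =>
    kltc_continuousOn_add_apply (A := fun _ => (1 : Matrix ι ι ℂ)) (B := fun t => diagonal (w₂ t) * Γ₂ 0)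
      (fun _ _ => continuousOn_const)
      (kltc_continuousOn_mul_apply (A := fun t => diagonal (w₂ t)) (B := fun _ => Γ₂ 0) (kltc_continuousOn_diagonal_apply hw₂c)
        (fun _ _ => continuousOn_const)) a c
  -- row / column sums of the conjugators
  have hQcol : ∀ t ∈ Icc (0 : ℝ) 1, ∀ c, ∑ c', ‖Q t c' c‖ ≤ 4 / 3 := by
    intro t ht c
    have h0 := kltc_colsum_affine_le (Γ₂ 0) (w₂ t) c
    have h1 : ∑ c', ‖w₂ t c'‖ * ‖Γ₂ 0 c' c‖ ≤ ∑ c', ρ₂ c' * m :=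
      sum_le_sum fun c' _ => mul_le_mul (hw₂n t ht c') (hΓ₂ 0 h01 c' c) (norm_nonneg _) (hρ₂0 c')
    have h2 : ∑ c', ρ₂ c' * m = m * ∑ c', ρ₂ c' := by rw [← sum_mul, mul_comm]
    exact h0.trans (by linarith)
  have hProw : ∀ t ∈ Icc (0 : ℝ) 1, ∀ a, ∑ a', ‖P t a a'‖ ≤ 4 / 3 := by
    intro t ht a
    have h0 := kltc_rowsum_affine_le (Γ₁ 0) (w₁ t) a
    have h1 : ∑ a', ‖Γ₁ 0 a a'‖ * ‖w₁ t a'‖ ≤ ∑ a', m * ρ₁ a' :=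
      sum_le_sum fun a' _ => mul_le_mul (hΓ₁ 0 h01 a a') (hw₁n t ht a') (norm_nonneg _) hm
    have h2 : ∑ a', m * ρ₁ a' = m * ∑ a', ρ₁ a' := by rw [← mul_sum]
    exact h0.trans (by linarith)
  -- the derivative of the conjugated object, product-rule form
  set D' : ℝ → Matrix ι ι ℂ := fun t => Γ₁ 0 * diagonal (b₁' t) * E t * Q t + P t * E' t * Q t +
    P t * E t * (diagonal (b₂' t) * Γ₂ 0) with hD'_def
  have hDderiv : ∀ t ∈ Icc (0 : ℝ) 1, ∀ a c, HasDerivAt (fun s => (P s * E s * Q s) a c) (D' t a c) t :=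
    fun t ht a c => kltc_tangent_conj_hasDerivAt E E' (Γ₁ 0) (Γ₂ 0) w₁ w₂ b₁' b₂' (hE t ht) (hw₁d t ht) (hw₂d t ht) a c
  -- … and its identity form
  have hD'id : ∀ t ∈ Icc (0 : ℝ) 1, D' t = -(P t * Γ₁ t - Γ₁ 0) * diagonal (b₁' t) * E t * Q t -
      P t * E t * diagonal (b₂' t) * (Γ₂ t * Q t - Γ₂ 0) + P t * X t * Q t :=
    fun t ht => kltc_tangent_conj_identity (E t) (E' t) (X t) (Γ₁ t) (Γ₂ t) (Γ₁ 0) (Γ₂ 0) (diagonal (w₁ t)) (diagonal (w₂ t))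
      (diagonal (b₁' t)) (diagonal (b₂' t)) (hflow t ht)
  -- continuity of `D'` entries
  have hD'c : ∀ a c, ContinuousOn (fun t => D' t a c) (Icc 0 1) := by
    intro a c
    have hT1 : ∀ u v, ContinuousOn (fun t => (Γ₁ 0 * diagonal (b₁' t) * E t * Q t) u v) (Icc 0 1) :=
      kltc_continuousOn_mul_apply (A := fun t => Γ₁ 0 * diagonal (b₁' t) * E t) (B := Q)
        (kltc_continuousOn_mul_apply (A := fun t => Γ₁ 0 * diagonal (b₁' t)) (B := E)
          (kltc_continuousOn_mul_apply (A := fun _ => Γ₁ 0) (B := fun t => diagonal (b₁' t)) (fun _ _ => continuousOn_const)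
            (kltc_continuousOn_diagonal_apply hb₁'c)) hEc) hQc
    have hT2 : ∀ u v, ContinuousOn (fun t => (P t * E' t * Q t) u v) (Icc 0 1) :=
      kltc_continuousOn_mul_apply (A := fun t => P t * E' t) (B := Q) (kltc_continuousOn_mul_apply (A := P) (B := E') hPc hE'c) hQc
    have hT3 : ∀ u v, ContinuousOn (fun t => (P t * E t * (diagonal (b₂' t) * Γ₂ 0)) u v) (Icc 0 1) :=
      kltc_continuousOn_mul_apply (A := fun t => P t * E t) (B := fun t => diagonal (b₂' t) * Γ₂ 0)
        (kltc_continuousOn_mul_apply (A := P) (B := E) hPc hEc)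
        (kltc_continuousOn_mul_apply (A := fun t => diagonal (b₂' t)) (B := fun _ => Γ₂ 0) (kltc_continuousOn_diagonal_apply hb₂'c)
          (fun _ _ => continuousOn_const))
    exact kltc_continuousOn_add_apply (A := fun t => Γ₁ 0 * diagonal (b₁' t) * E t * Q t + P t * E' t * Q t)
      (B := fun t => P t * E t * (diagonal (b₂' t) * Γ₂ 0)) (kltc_continuousOn_add_apply hT1 hT2) hT3 a c
  -- the pointwise majorant of `D'`
  set θ : ℝ := 4 / 3 * B * β * (η₁ + η₂) with hθ_def
  set g : ℝ → ι → ι → ℝ := fun t a c => ‖X t a c‖ + ∑ c', ‖X t a c'‖ * ρ₂ c' * m + ∑ a', m * ρ₁ a' * ‖X t a' c‖ +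
    ∑ a', ∑ c', m * ρ₁ a' * ‖X t a' c'‖ * ρ₂ c' * m with hg_def
  have hD'le : ∀ t ∈ Icc (0 : ℝ) 1, ∀ a c, ‖D' t a c‖ ≤ g t a c + θ := by
    intro t ht a c
    -- term 3: the conjugated source
    have h3 : ‖(P t * X t * Q t) a c‖ ≤ g t a c := by
      refine (kltc_sandwich2_entry_le (Γ₁ 0) (X t) (Γ₂ 0) (w₁ t) (w₂ t) a c).trans ?_
      have e2 : ∑ c', ‖X t a c'‖ * ‖w₂ t c'‖ * ‖Γ₂ 0 c' c‖ ≤ ∑ c', ‖X t a c'‖ * ρ₂ c' * m :=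
        sum_le_sum fun c' _ => mul_le_mul (mul_le_mul_of_nonneg_left (hw₂n t ht c') (norm_nonneg _)) (hΓ₂ 0 h01 c' c)
          (norm_nonneg _) (mul_nonneg (norm_nonneg _) (hρ₂0 c'))
      have e3 : ∑ a', ‖Γ₁ 0 a a'‖ * ‖w₁ t a'‖ * ‖X t a' c‖ ≤ ∑ a', m * ρ₁ a' * ‖X t a' c‖ :=
        sum_le_sum fun a' _ => mul_le_mul_of_nonneg_right (mul_le_mul (hΓ₁ 0 h01 a a') (hw₁n t ht a') (norm_nonneg _) hm)
          (norm_nonneg _)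
      have e4 : ∑ a', ∑ c', ‖Γ₁ 0 a a'‖ * ‖w₁ t a'‖ * ‖X t a' c'‖ * ‖w₂ t c'‖ * ‖Γ₂ 0 c' c‖ ≤
          ∑ a', ∑ c', m * ρ₁ a' * ‖X t a' c'‖ * ρ₂ c' * m :=
        sum_le_sum fun a' _ => sum_le_sum fun c' _ => by
          have g1 : ‖Γ₁ 0 a a'‖ * ‖w₁ t a'‖ ≤ m * ρ₁ a' := mul_le_mul (hΓ₁ 0 h01 a a') (hw₁n t ht a') (norm_nonneg _) hm
          have g2 : ‖Γ₁ 0 a a'‖ * ‖w₁ t a'‖ * ‖X t a' c'‖ * ‖w₂ t c'‖ ≤ m * ρ₁ a' * ‖X t a' c'‖ * ρ₂ c' :=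
            mul_le_mul (mul_le_mul_of_nonneg_right g1 (norm_nonneg _)) (hw₂n t ht c') (norm_nonneg _)
              (mul_nonneg (mul_nonneg hm (hρ₁0 a')) (norm_nonneg _))
          exact mul_le_mul g2 (hΓ₂ 0 h01 c' c) (norm_nonneg _)
            (mul_nonneg (mul_nonneg (mul_nonneg hm (hρ₁0 a')) (norm_nonneg _)) (hρ₂0 c'))
      simp only [hg_def]
      linarith
    -- term 1: left defect × rate × E × Q
    have h1 : ‖((P t * Γ₁ t - Γ₁ 0) * diagonal (b₁' t) * E t * Q t) a c‖ ≤ 4 / 3 * B * β * η₁ := by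
      have hin : ∀ c', ‖((P t * Γ₁ t - Γ₁ 0) * diagonal (b₁' t) * E t) a c'‖ ≤ η₁ * β * B := by
        intro c'
        rw [klli_mul_diag_mul_apply]
        calc ‖∑ a', (P t * Γ₁ t - Γ₁ 0) a a' * b₁' t a' * E t a' c'‖
            ≤ ∑ a', ‖(P t * Γ₁ t - Γ₁ 0) a a'‖ * ‖b₁' t a'‖ * ‖E t a' c'‖ :=
              (norm_sum_le _ _).trans (le_of_eq (sum_congr rfl fun a' _ => by rw [norm_mul, norm_mul]))
          _ ≤ ∑ a', η₁ * ‖b₁' t a'‖ * B :=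
              sum_le_sum fun a' _ => mul_le_mul (mul_le_mul_of_nonneg_right (hdef₁' t ht a a') (norm_nonneg _)) (hEB t ht a' c')
                (norm_nonneg _) (mul_nonneg hη₁ (norm_nonneg _))
          _ = η₁ * (∑ a', ‖b₁' t a'‖) * B := by rw [mul_sum, sum_mul]
          _ ≤ η₁ * β * B := mul_le_mul_of_nonneg_right (mul_le_mul_of_nonneg_left (hβ₁ t ht) hη₁) hB
      rw [Matrix.mul_apply]
      calc ‖∑ c', ((P t * Γ₁ t - Γ₁ 0) * diagonal (b₁' t) * E t) a c' * Q t c' c‖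
          ≤ ∑ c', ‖((P t * Γ₁ t - Γ₁ 0) * diagonal (b₁' t) * E t) a c'‖ * ‖Q t c' c‖ :=
            (norm_sum_le _ _).trans (le_of_eq (sum_congr rfl fun c' _ => norm_mul _ _))
        _ ≤ ∑ c', (η₁ * β * B) * ‖Q t c' c‖ := sum_le_sum fun c' _ => mul_le_mul_of_nonneg_right (hin c') (norm_nonneg _)
        _ = (η₁ * β * B) * ∑ c', ‖Q t c' c‖ := by rw [mul_sum]
        _ ≤ (η₁ * β * B) * (4 / 3) := mul_le_mul_of_nonneg_left (hQcol t ht c) (by positivity)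
        _ = 4 / 3 * B * β * η₁ := by ring
    -- term 2: P × E × rate × right defect
    have h2 : ‖(P t * E t * diagonal (b₂' t) * (Γ₂ t * Q t - Γ₂ 0)) a c‖ ≤ 4 / 3 * B * β * η₂ := by
      have hin : ∀ a', ‖(E t * diagonal (b₂' t) * (Γ₂ t * Q t - Γ₂ 0)) a' c‖ ≤ B * β * η₂ := by
        intro a'
        rw [klli_mul_diag_mul_apply]
        calc ‖∑ c', E t a' c' * b₂' t c' * (Γ₂ t * Q t - Γ₂ 0) c' c‖
            ≤ ∑ c', ‖E t a' c'‖ * ‖b₂' t c'‖ * ‖(Γ₂ t * Q t - Γ₂ 0) c' c‖ :=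
              (norm_sum_le _ _).trans (le_of_eq (sum_congr rfl fun c' _ => by rw [norm_mul, norm_mul]))
          _ ≤ ∑ c', B * ‖b₂' t c'‖ * η₂ :=
              sum_le_sum fun c' _ => mul_le_mul (mul_le_mul_of_nonneg_right (hEB t ht a' c') (norm_nonneg _)) (hdef₂' t ht c' c)
                (norm_nonneg _) (mul_nonneg hB (norm_nonneg _))
          _ = B * (∑ c', ‖b₂' t c'‖) * η₂ := by rw [mul_sum, sum_mul]
          _ ≤ B * β * η₂ := mul_le_mul_of_nonneg_right (mul_le_mul_of_nonneg_left (hβ₂ t ht) hB) hη₂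
      have hassoc : P t * E t * diagonal (b₂' t) * (Γ₂ t * Q t - Γ₂ 0) = P t * (E t * diagonal (b₂' t) * (Γ₂ t * Q t - Γ₂ 0)) := by
        simp only [Matrix.mul_assoc]
      rw [hassoc, Matrix.mul_apply]
      calc ‖∑ a', P t a a' * (E t * diagonal (b₂' t) * (Γ₂ t * Q t - Γ₂ 0)) a' c‖
          ≤ ∑ a', ‖P t a a'‖ * ‖(E t * diagonal (b₂' t) * (Γ₂ t * Q t - Γ₂ 0)) a' c‖ :=
            (norm_sum_le _ _).trans (le_of_eq (sum_congr rfl fun a' _ => norm_mul _ _))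
        _ ≤ ∑ a', ‖P t a a'‖ * (B * β * η₂) := sum_le_sum fun a' _ => mul_le_mul_of_nonneg_left (hin a') (norm_nonneg _)
        _ = (∑ a', ‖P t a a'‖) * (B * β * η₂) := by rw [sum_mul]
        _ ≤ 4 / 3 * (B * β * η₂) := mul_le_mul_of_nonneg_right (hProw t ht a) (by positivity)
        _ = 4 / 3 * B * β * η₂ := by ring
    -- combine
    rw [hD'id t ht, Matrix.add_apply, Matrix.sub_apply]
    have hneg : (-(P t * Γ₁ t - Γ₁ 0) * diagonal (b₁' t) * E t * Q t) a c =
        -(((P t * Γ₁ t - Γ₁ 0) * diagonal (b₁' t) * E t * Q t) a c) := by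
      simp only [neg_mul, Matrix.neg_apply]
    rw [hneg]
    set u := ((P t * Γ₁ t - Γ₁ 0) * diagonal (b₁' t) * E t * Q t) a c with hu
    set v := (P t * E t * diagonal (b₂' t) * (Γ₂ t * Q t - Γ₂ 0)) a c with hv
    set z := (P t * X t * Q t) a c with hz
    calc ‖-u - v + z‖ ≤ ‖-u - v‖ + ‖z‖ := norm_add_le _ _
      _ ≤ ‖-u‖ + ‖v‖ + ‖z‖ := add_le_add (norm_sub_le _ _) le_rfl
      _ = ‖u‖ + ‖v‖ + ‖z‖ := by rw [norm_neg]
      _ ≤ 4 / 3 * B * β * η₁ + 4 / 3 * B * β * η₂ + g t a c := add_le_add (add_le_add h1 h2) h3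
      _ = g t a c + θ := by simp only [hθ_def]; ring
  -- FTC for the conjugated object
  have hFTC : ∀ a c, (∫ t in (0 : ℝ)..1, D' t a c) = (P 1 * E 1 * Q 1) a c - E 0 a c := by
    intro a c
    have h := intervalIntegral.integral_eq_sub_of_hasDerivAt (f := fun s => (P s * E s * Q s) a c)
      (fun t ht => hDderiv t (hsub ht) a c) ((hD'c a c).mono hsub).intervalIntegrable
    rw [h, hP0, hQ0, one_mul, mul_one]
  -- continuity and integral of the majorant
  have hn : ∀ u v, ContinuousOn (fun t => ‖X t u v‖) (Icc 0 1) := fun u v => (hXc u v).norm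
  have hni : ∀ u v, IntervalIntegrable (fun t => ‖X t u v‖) MeasureTheory.volume 0 1 :=
    fun u v => ((hn u v).mono hsub).intervalIntegrable
  have hmaj : ∀ a c, ContinuousOn (fun t => g t a c) (Icc 0 1) ∧
      (∫ t in (0 : ℝ)..1, g t a c) ≤ I a c + ∑ c', I a c' * ρ₂ c' * m + ∑ a', m * ρ₁ a' * I a' c +
        ∑ a', ∑ c', m * ρ₁ a' * I a' c' * ρ₂ c' * m := by
    intro a c
    have hc₀ : ContinuousOn (fun t => ‖X t a c‖) (Icc 0 1) := hn a c
    have hc₁ : ContinuousOn (fun t => ∑ c', ‖X t a c'‖ * ρ₂ c' * m) (Icc 0 1) :=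
      continuousOn_finsetSum _ fun c' _ => ((hn a c').mul continuousOn_const).mul continuousOn_const
    have hc₂ : ContinuousOn (fun t => ∑ a', m * ρ₁ a' * ‖X t a' c‖) (Icc 0 1) :=
      continuousOn_finsetSum _ fun a' _ => continuousOn_const.mul (hn a' c)
    have hc₃ : ContinuousOn (fun t => ∑ a', ∑ c', m * ρ₁ a' * ‖X t a' c'‖ * ρ₂ c' * m) (Icc 0 1) :=
      continuousOn_finsetSum _ fun a' _ => continuousOn_finsetSum _ fun c' _ =>
        ((continuousOn_const.mul (hn a' c')).mul continuousOn_const).mul continuousOn_const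
    have hi₀ : IntervalIntegrable (fun t => ‖X t a c‖) MeasureTheory.volume 0 1 := (hc₀.mono hsub).intervalIntegrable
    have hi₁ : IntervalIntegrable (fun t => ∑ c', ‖X t a c'‖ * ρ₂ c' * m) MeasureTheory.volume 0 1 :=
      (hc₁.mono hsub).intervalIntegrable
    have hi₂ : IntervalIntegrable (fun t => ∑ a', m * ρ₁ a' * ‖X t a' c‖) MeasureTheory.volume 0 1 :=
      (hc₂.mono hsub).intervalIntegrable
    have hi₃ : IntervalIntegrable (fun t => ∑ a', ∑ c', m * ρ₁ a' * ‖X t a' c'‖ * ρ₂ c' * m) MeasureTheory.volume 0 1 :=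
      (hc₃.mono hsub).intervalIntegrable
    have hgc : ContinuousOn (fun t => g t a c) (Icc 0 1) := by
      simp only [hg_def]
      exact ((hc₀.add hc₁).add hc₂).add hc₃
    refine ⟨hgc, ?_⟩
    have e : (∫ t in (0 : ℝ)..1, g t a c) = (∫ t in (0 : ℝ)..1, ‖X t a c‖) + (∫ t in (0 : ℝ)..1, ∑ c', ‖X t a c'‖ * ρ₂ c' * m) +
        (∫ t in (0 : ℝ)..1, ∑ a', m * ρ₁ a' * ‖X t a' c‖) + (∫ t in (0 : ℝ)..1, ∑ a', ∑ c', m * ρ₁ a' * ‖X t a' c'‖ * ρ₂ c' * m) := by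
      simp only [hg_def]
      rw [intervalIntegral.integral_add ((hi₀.add hi₁).add hi₂) hi₃, intervalIntegral.integral_add (hi₀.add hi₁) hi₂,
        intervalIntegral.integral_add hi₀ hi₁]
    have e₁ : (∫ t in (0 : ℝ)..1, ∑ c', ‖X t a c'‖ * ρ₂ c' * m) = ∑ c', (∫ t in (0 : ℝ)..1, ‖X t a c'‖) * ρ₂ c' * m := by
      rw [intervalIntegral.integral_finsetSum (fun c' _ => ((hni a c').mul_const _).mul_const _)]
      exact sum_congr rfl fun c' _ => by rw [intervalIntegral.integral_mul_const, intervalIntegral.integral_mul_const]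
    have e₂ : (∫ t in (0 : ℝ)..1, ∑ a', m * ρ₁ a' * ‖X t a' c‖) = ∑ a', m * ρ₁ a' * ∫ t in (0 : ℝ)..1, ‖X t a' c‖ := by
      rw [intervalIntegral.integral_finsetSum (fun a' _ => (hni a' c).const_mul _)]
      exact sum_congr rfl fun a' _ => intervalIntegral.integral_const_mul _ _
    have e₃ : (∫ t in (0 : ℝ)..1, ∑ a', ∑ c', m * ρ₁ a' * ‖X t a' c'‖ * ρ₂ c' * m) =
        ∑ a', ∑ c', m * ρ₁ a' * (∫ t in (0 : ℝ)..1, ‖X t a' c'‖) * ρ₂ c' * m := by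
      rw [intervalIntegral.integral_finsetSum (fun a' _ => ?_)]
      · refine sum_congr rfl fun a' _ => ?_
        rw [intervalIntegral.integral_finsetSum (fun c' _ => (((hni a' c').const_mul _).mul_const _).mul_const _)]
        refine sum_congr rfl fun c' _ => ?_
        rw [intervalIntegral.integral_mul_const, intervalIntegral.integral_mul_const, intervalIntegral.integral_const_mul]
      · exact ((continuousOn_finsetSum _ fun c' _ =>
          ((continuousOn_const.mul (hn a' c')).mul continuousOn_const).mul continuousOn_const).mono hsub).intervalIntegrable
    rw [e, e₁, e₂, e₃]
    refine add_le_add (add_le_add (add_le_add (hI a c) ?_) ?_) ?_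
    · exact sum_le_sum fun c' _ => mul_le_mul_of_nonneg_right (mul_le_mul_of_nonneg_right (hI a c') (hρ₂0 c')) hm
    · exact sum_le_sum fun a' _ => mul_le_mul_of_nonneg_left (hI a' c) (mul_nonneg hm (hρ₁0 a'))
    · exact sum_le_sum fun a' _ => sum_le_sum fun c' _ =>
        mul_le_mul_of_nonneg_right (mul_le_mul_of_nonneg_right (mul_le_mul_of_nonneg_left (hI a' c') (mul_nonneg hm (hρ₁0 a')))
          (hρ₂0 c')) hm
  -- the conjugated object at `t = 1` is majorised by `S`
  have hkey : ∀ a c, ‖(P 1 * E 1 * Q 1) a c‖ ≤ S a c := by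
    intro a c
    obtain ⟨hgc, hgI⟩ := hmaj a c
    have hgi : IntervalIntegrable (fun t => g t a c) MeasureTheory.volume 0 1 := (hgc.mono hsub).intervalIntegrable
    have hbound : ‖(P 1 * E 1 * Q 1) a c - E 0 a c‖ ≤ (I a c + ∑ c', I a c' * ρ₂ c' * m + ∑ a', m * ρ₁ a' * I a' c +
        ∑ a', ∑ c', m * ρ₁ a' * I a' c' * ρ₂ c' * m) + θ := by
      rw [← hFTC a c]
      refine (intervalIntegral.norm_integral_le_of_norm_le zero_le_one ?_ (hgi.add (intervalIntegrable_const (c := θ)))).trans ?_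
      · exact Filter.Eventually.of_forall fun t ht => hD'le t ⟨ht.1.le, ht.2⟩ a c
      · rw [intervalIntegral.integral_add hgi (intervalIntegrable_const (c := θ)), intervalIntegral.integral_const, sub_zero, one_smul]
        exact add_le_add hgI le_rfl
    calc ‖(P 1 * E 1 * Q 1) a c‖ = ‖E 0 a c + ((P 1 * E 1 * Q 1) a c - E 0 a c)‖ := by rw [add_sub_cancel]
      _ ≤ ‖E 0 a c‖ + ‖(P 1 * E 1 * Q 1) a c - E 0 a c‖ := norm_add_le _ _
      _ ≤ S a c := by linarith [hS a c]
  -- undo the conjugation at `t = 1`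
  have hθ₁ : m * ∑ a, ‖w₁ 1 a‖ ≤ 1 / 3 := (mul_le_mul_of_nonneg_left (sum_le_sum fun a _ => hw₁n 1 h11 a) hm).trans hZ₁
  have hθ₂ : m * ∑ a, ‖w₂ 1 a‖ ≤ 1 / 3 := (mul_le_mul_of_nonneg_left (sum_le_sum fun a _ => hw₂n 1 h11 a) hm).trans hZ₂
  obtain ⟨N₁, M₁, -, -, -, hM₁2, hCN₁, -, -, hCNb₁, -, -⟩ := klcrs_single_slice (w₁ 1) hm (Γ₁ 0) (hΓ₁ 0 h01) hθ₁
  obtain ⟨N₂, -, hN₂1, -, -, -, -, -, -, hCNb₂, -, -⟩ := klcrs_single_slice (w₂ 1) hm (Γ₂ 0) (hΓ₂ 0 h01) hθ₂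
  have hE1 : E 1 = M₁ * (P 1 * E 1 * Q 1) * N₂ := by
    have hMP : M₁ * P 1 = 1 := hM₁2
    have hQN : Q 1 * N₂ = 1 := hN₂1
    calc E 1 = (M₁ * P 1) * E 1 * (Q 1 * N₂) := by rw [hMP, hQN, one_mul, mul_one]
      _ = M₁ * (P 1 * E 1 * Q 1) * N₂ := by simp only [Matrix.mul_assoc]
  have hM₁aff : M₁ = 1 + (-(Γ₁ 0 * N₁)) * diagonal (w₁ 1) := by
    have h1 : M₁ = 1 - M₁ * Γ₁ 0 * diagonal (w₁ 1) := by
      calc M₁ = M₁ * (1 + Γ₁ 0 * diagonal (w₁ 1)) - M₁ * Γ₁ 0 * diagonal (w₁ 1) := by noncomm_ring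
        _ = 1 - M₁ * Γ₁ 0 * diagonal (w₁ 1) := by rw [hM₁2]
    rw [h1, ← hCN₁, neg_mul, sub_eq_add_neg]
  have hN₂aff : N₂ = 1 + diagonal (w₂ 1) * (-(Γ₂ 0 * N₂)) := by
    rw [mul_neg, ← sub_eq_add_neg]
    exact klli_rightInv_expand (Γ₂ 0) (diagonal (w₂ 1)) N₂ hN₂1
  have hC' : ∀ u v, ‖(-(Γ₁ 0 * N₁)) u v‖ ≤ 3 / 2 * m := fun u v => by rw [Matrix.neg_apply, norm_neg]; exact hCNb₁ u v
  have hT : ∀ u v, ‖(-(Γ₂ 0 * N₂)) u v‖ ≤ 3 / 2 * m := fun u v => by rw [Matrix.neg_apply, norm_neg]; exact hCNb₂ u v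
  have hS0 : ∀ u v, 0 ≤ S u v := fun u v => (norm_nonneg _).trans (hkey u v)
  have hm' : 0 ≤ 3 / 2 * m := by positivity
  rw [hE1, hM₁aff, hN₂aff]
  refine (kltc_sandwich2_entry_le (-(Γ₁ 0 * N₁)) (P 1 * E 1 * Q 1) (-(Γ₂ 0 * N₂)) (w₁ 1) (w₂ 1) x y).trans ?_
  refine add_le_add (add_le_add (add_le_add (hkey x y) ?_) ?_) ?_
  · exact sum_le_sum fun c _ =>
      mul_le_mul (mul_le_mul (hkey x c) (hw₂n 1 h11 c) (norm_nonneg _) (hS0 x c)) (hT c y) (norm_nonneg _)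
        (mul_nonneg (hS0 x c) (hρ₂0 c))
  · exact sum_le_sum fun a _ =>
      mul_le_mul (mul_le_mul (hC' x a) (hw₁n 1 h11 a) (norm_nonneg _) hm') (hkey a y) (norm_nonneg _)
        (mul_nonneg hm' (hρ₁0 a))
  · exact sum_le_sum fun a _ => sum_le_sum fun c _ => by
      have g1 : ‖(-(Γ₁ 0 * N₁)) x a‖ * ‖w₁ 1 a‖ ≤ 3 / 2 * m * ρ₁ a := mul_le_mul (hC' x a) (hw₁n 1 h11 a) (norm_nonneg _) hm'
      have g2 : ‖(-(Γ₁ 0 * N₁)) x a‖ * ‖w₁ 1 a‖ * ‖(P 1 * E 1 * Q 1) a c‖ * ‖w₂ 1 c‖ ≤ 3 / 2 * m * ρ₁ a * S a c * ρ₂ c :=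
        mul_le_mul (mul_le_mul g1 (hkey a c) (norm_nonneg _) (mul_nonneg hm' (hρ₁0 a))) (hw₂n 1 h11 c) (norm_nonneg _)
          (mul_nonneg (mul_nonneg hm' (hρ₁0 a)) (hS0 a c))
      exact mul_le_mul g2 (hT c y) (norm_nonneg _) (mul_nonneg (mul_nonneg (mul_nonneg hm' (hρ₁0 a)) (hS0 a c)) (hρ₂0 c))

end TangentDuhamel

end Summit.HubbardSuperconductivity.HubbardSuperconductivity.Theorems.KLRegimeSplit

end
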